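import Summits.Langlands.Langlands.Theorems.IrreducibilityBySelfDualityPairLBoundaryJS
import Summits.Langlands.Langlands.Theorems.IrreducibilityBySelfDualityPairLBoundaryJSSsv
import Summits.Langlands.Langlands.Theorems.IrreducibilityBySelfDualityPairLBoundaryJSStandardEntire
import Summits.Langlands.Langlands.Theorems.IrreducibilityBySelfDualityPairLBoundaryJSIsOrthoOfLocalTranslate
import Summits.Langlands.Langlands.Theorems.IrreducibilityBySelfDualityPairLBoundaryJSEqConjOfLocalTranslate
import Summits.Langlands.Langlands.Theorems.IrreducibilityBySelfDualityPairLBoundaryJSLocalPairTranslate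
import Summits.Langlands.Langlands.Theorems.IrreducibilityBySelfDualityPairLBoundaryJSOfHumphriesJo
import Summits.Langlands.Langlands.Theorems.IrreducibilityBySelfDualityPairLBoundaryJSCornerAbsMajorant
import Literature.NumberTheory.Automorphic.PairLFunctionMeromorphicContinuationRankNeTwistProofs
import Literature.NumberTheory.Automorphic.ArchRankinSelbergTestVector
import Literature.NumberTheory.Automorphic.JPSSGlobalIntegralQuotientUnfolding
import Literature.NumberTheory.Automorphic.JPSSCornerWhittakerUnfolding
import Literature.NumberTheory.Automorphic.WhittakerPeriodExchange
import Literature.NumberTheory.Automorphic.TorusIwasawaTransport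
import Literature.NumberTheory.Automorphic.CornerTorusIwasawaData
import Literature.NumberTheory.Automorphic.WhittakerCoeffHonestCuspForm
import Literature.NumberTheory.Automorphic.WhittakerCoeffTranslateUnramified
import Literature.NumberTheory.Automorphic.WhittakerDecayCuspForm
import Literature.NumberTheory.Automorphic.WhittakerSupportFinite
import Literature.NumberTheory.Automorphic.RankinSelbergUnramifiedTorus
import Literature.NumberTheory.Automorphic.RankinSelbergTorusPairEuler
import Literature.NumberTheory.Automorphic.RankinSelbergTowerFiniteness

/-!
# The gauge majorant of `W_φ` at the corner torus points `diag(diag(a) k, 1_{n-m})` of `GL_n`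

Summit `Langlands`, sub-problem `Langlands`, helper file under `Theorems/` supporting the crux
`PairLBoundaryJS` (stmt-Langlands-13622), line `Sketch`, registered stub `stub_gap_abs_convergence` (G-Ac),
part 1 of 2 (the Iwasawa data of the `GL_n` corner torus points, the finite support and the
single-coordinate archimedean decay; part 2: `…GapAbsConvergence`, the product majorant and the stub). The
`GL_n × GL_m` (`0 < m < n`) version of `…CornerAbsMajorant` (which is the case `n = m + 1`): for a cusp form
`φ` on `GL_n(𝔸_K)` and its global Whittaker function `W_φ = whittakerDepth 0 φ`, at the torus points
`ι(diag(a) k)`, `ι = glCorner (m ≤ n) : h ↦ diag(h, 1_{n-m})`, of the unfolded `GL_n × GL_m` integral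
(Cogdell (2004), §2.2–2.3 "the gauge estimates"; Jacquet–Piatetski-Shapiro–Shalika (1983), §2):

* `glCorner_glDiagonal_eq_glDiagonal_cornerExtend`, `sndHom_glCorner_torusPoint`,
  `exists_toMixed_glCorner_torusPoint` — the finite and archimedean **Iwasawa data** of `ι(diag(a) k)`:
  `diag(a_f, 1, …, 1) · ι(k_f)` with `ι(k_f) ∈ GL_n(𝒪̂)`, and `diag(dd) κ` with `κ ∈ K_∞`, `dd` of radii
  `‖a_{i,w}‖` (`i < m`) and `1` (`i ≥ m`) (`CornerTorusIwasawaData` with `Fin.snoc · 1` replaced by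
  `cornerExtend · 1`);
* `valued_le_pow_of_whittakerDepth_glCorner_ne_zero` — **finite support**: `W_φ(ι(diag(a)k)) ≠ 0` forces
  `|a_{l,v}|_v ≤ B_v^{m-l}` (`valued_lt_of_whittakerDepth_zero_ne_zero` chained down from the simple root
  `(m-1, m)`, whose second entry is `1`);
* `norm_whittakerDepth_glCorner_mul_pow_le` — **archimedean decay** in every coordinate `a_l` at every
  infinite place, uniformly in `k` (`exists_norm_whittakerDepth_zero_mul_pow_le` at the coordinate
  `Fin.castLE _ l`, the last radius being `1` as `m < n`); `stub_gap_single_decay` — its registered `∀`-form.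

## References

* J. W. Cogdell, *Analytic theory of L-functions for GL_n*, in *An Introduction to the Langlands
  Program* (2004), Thm. 1.1, §2.2–2.3 [CogdellAnalyticTheory2004].
* H. Jacquet, I. I. Piatetski-Shapiro, J. Shalika, *Rankin–Selberg convolutions*, Amer. J. Math. 105
  (1983), §2 [JPSS1983].
-/

noncomputable section

-- `Summit.Langlands.Langlands.…` (summit = sub-problem name, D-0017 layout) trips `dupNamespace`
set_option linter.dupNamespace false

open scoped MatrixGroups Topology Pointwise ENNReal NNReal ComplexConjugate InnerProductSpace ContDiff
-- the place subtypes indexing `mixedSpace K` are `Fintype` classically (`NormedCommRing (mixedSpace K)`)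
open scoped Classical Matrix.Norms.Operator
open NumberField IsDedekindDomain MeasureTheory Measure Matrix Set Filter WithZero
open NumberField.mixedEmbedding
open Literature.NumberTheory.Automorphic AdelicGroupData
open Literature.NumberTheory.GaloisRepresentations (ideleGroup HeckeCharacter)
open Literature.MeasureTheory.Group
open Literature.RingTheory.SymmetricFunctions.SymmPoly
open ValuativeRel

-- the automorphic quotient carries the tree's Borel σ-algebra, not Mathlib's quotient σ-algebra
attribute [-instance] Quotient.instMeasurableSpace QuotientGroup.measurableSpace

-- the house local instances, exactly as in `RankinSelbergUnfoldingIdentity`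
attribute [local instance] adelicBorel borelSpace_adelic locallyCompactSpace_adelic secondCountableTopology_gl_adelic
  glAdeleBorel borelSpace_glAdele borelSpace_ideleGroup secondCountableTopology_ideleGroup

-- Mathlib idiom: the commutator Lie ring on matrices, to mention `(archGroupGL n K).lie`
attribute [local instance 100] LieRing.ofAssociativeRing


namespace Summit.Langlands.Langlands.Theorems.GapAbsMajorant

/-! ### The Iwasawa data of the `GL_n` corner torus points -/

section Iwasawa

variable {n m : ℕ} {K : Type} [Field K] [NumberField K]

/-- `cornerExtend h f c` is `f` on the first `m` coordinates (in `ℕ`-coordinates). [folklore] -/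
theorem cornerExtend_apply_of_lt {X : Type*} (h : m ≤ n) (f : Fin m → X) (c : X) (i : Fin n)
    (hi : (i : ℕ) < m) : cornerExtend h f c i = f ⟨i, hi⟩ := by
  show Sum.elim f (fun _ => c) ((finBlockEquiv h).symm i) = _
  rw [finBlockEquiv_symm_of_lt h i hi, Sum.elim_inl]

/-- `cornerExtend h f c` is `c` on the last `n - m` coordinates (in `ℕ`-coordinates). [folklore] -/
theorem cornerExtend_apply_of_le {X : Type*} (h : m ≤ n) (f : Fin m → X) (c : X) (i : Fin n)
    (hi : m ≤ (i : ℕ)) : cornerExtend h f c i = c := by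
  show Sum.elim f (fun _ => c) ((finBlockEquiv h).symm i) = _
  rw [finBlockEquiv_symm_of_le h i hi, Sum.elim_inr]

/-- **`diag(diag(d), 1_{n-m}) = diag(d, 1, …, 1)`.** [folklore] -/
theorem glCorner_glDiagonal_eq_glDiagonal_cornerExtend {R : Type*} [CommRing R] (h : m ≤ n) (d : Fin m → Rˣ) :
    glCorner R h (glDiagonal m R d) = glDiagonal n R (cornerExtend h d 1) := by
  refine Matrix.GeneralLinearGroup.ext fun i j => ?_
  rw [glCorner_apply_val, coe_glDiagonal, coe_glDiagonal, Matrix.diagonal_apply]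
  by_cases hi : (i : ℕ) < m <;> by_cases hj : (j : ℕ) < m
  · rw [dif_pos hi, dif_pos hj, Matrix.diagonal_apply]
    by_cases hij : i = j
    · subst hij
      rw [if_pos rfl, if_pos rfl, cornerExtend_apply_of_lt h d 1 i hi]
    · have hij' : (⟨i, hi⟩ : Fin m) ≠ ⟨j, hj⟩ := fun e => hij (Fin.ext (Fin.mk.inj_iff.mp e))
      rw [if_neg hij', if_neg hij]
  · rw [dif_pos hi, dif_neg hj, if_neg (fun e : i = j => hj (e ▸ hi))]
  · rw [dif_neg hi, if_pos hj, if_neg (fun e : i = j => hi (e ▸ hj))]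
  · rw [dif_neg hi, if_neg hj]
    by_cases hij : i = j
    · subst hij
      rw [if_pos rfl, if_pos rfl, cornerExtend_apply_of_le h d 1 i (not_lt.1 hi), Units.val_one]
    · rw [if_neg hij, if_neg hij]

/-- **Finite Iwasawa data of `ι(diag(a) k) = diag(diag(a) k, 1_{n-m})`**: its finite part is
`diag(a_f, 1, …, 1) · ι(k_f)` with `ι(k_f) ∈ GL_n(𝒪̂)` for `k` in the standard maximal compact subgroup.
[folklore] -/
theorem sndHom_glCorner_torusPoint (h : m ≤ n) (a : Fin m → ideleGroup K)
    {k : GL (Fin m) (AdeleRing (𝓞 K) K)} (hk : k ∈ standardMaximalCompactGL m K) :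
    GLn.sndHom n K (glCorner (AdeleRing (𝓞 K) K) h (glDiagonal m (AdeleRing (𝓞 K) K) a * k)) =
      glDiagonal n (FiniteAdeleRing (𝓞 K) K)
          (cornerExtend h
            (fun i => Units.map (RingHom.snd (InfiniteAdeleRing K) (FiniteAdeleRing (𝓞 K) K)).toMonoidHom (a i)) 1) *
        glCorner (FiniteAdeleRing (𝓞 K) K) h (GLn.sndHom m K k) ∧
      glCorner (FiniteAdeleRing (𝓞 K) K) h (GLn.sndHom m K k) ∈ glFiniteIntegralLevel n K := by
  refine ⟨?_, glCorner_mem_glFiniteIntegralLevel h (sndHom_mem_of_mem_standardMaximalCompactGL hk)⟩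
  rw [GLn.sndHom_glCorner, map_mul, map_mul, GLn.sndHom_glDiagonal, glCorner_glDiagonal_eq_glDiagonal_cornerExtend]

/-- **Archimedean Iwasawa data of `ι(diag(a) k) = diag(diag(a) k, 1_{n-m})`.** For `a ∈ (𝔸_Kˣ)ᵐ` and `k` in
the standard maximal compact subgroup of `GL_m(𝔸_K)` there are `dd` and `κ ∈ K_∞^{(n)}` with
`(ι(diag(a) k))_∞ = diag(dd) κ`, where `eval_w (dd_i) = ‖a_{i,w}‖` for `i < m` and `eval_w (dd_i) = 1` for
`i ≥ m`, at every infinite place `w` (polar decomposition of the archimedean components of the `a_i`; the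
phases and `k_∞` go into `κ`). [folklore] -/
theorem exists_toMixed_glCorner_torusPoint (h : m ≤ n) (a : Fin m → ideleGroup K)
    {k : GL (Fin m) (AdeleRing (𝓞 K) K)} (hk : k ∈ standardMaximalCompactGL m K) :
    ∃ (dd : Fin n → (mixedSpace K)ˣ) (κ : GL (Fin n) (mixedSpace K)), κ ∈ Kinf n K ∧
      GLn.toMixed n K (glCorner (AdeleRing (𝓞 K) K) h (glDiagonal m (AdeleRing (𝓞 K) K) a * k)) =
        glDiagonal n (mixedSpace K) dd * κ ∧
      ∀ w : InfinitePlace K,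
        (∀ (i : Fin n) (hi : (i : ℕ) < m), mixedSpaceEvalAt K w (dd i : mixedSpace K) =
          ((‖((a ⟨i, hi⟩ : ideleGroup K) : AdeleRing (𝓞 K) K).1 w‖ : ℝ) : ℂ)) ∧
        ∀ i : Fin n, m ≤ (i : ℕ) → mixedSpaceEvalAt K w (dd i : mixedSpace K) = 1 := by
  -- the archimedean units of the `a i` and their radii
  set z : Fin m → (mixedSpace K)ˣ := fun i =>
    Units.map (InfiniteAdeleRing.ringEquiv_mixedSpace K).toRingHom.toMonoidHom
      (Units.map (RingHom.fst (InfiniteAdeleRing K) (FiniteAdeleRing (𝓞 K) K)).toMonoidHom (a i)) with hz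
  set ρ : Fin m → InfinitePlace K → ℝ := fun i w => ‖((a i : ideleGroup K) : AdeleRing (𝓞 K) K).1 w‖ with hρ
  have hzn : ∀ i w, ‖mixedSpaceEvalAt K w (z i : mixedSpace K)‖ = ρ i w :=
    fun i w => norm_mixedSpaceEvalAt_archUnit (a i) w
  have hρpos : ∀ i w, 0 < ρ i w := fun i w => by
    rw [← hzn i w]
    exact norm_pos_iff.2 (mixedSpaceEvalAt_unit_ne_zero (z i) w)
  set r : Fin m → (mixedSpace K)ˣ := fun i => mixedPosUnit K (ρ i) (hρpos i) with hr
  set p : Fin m → (mixedSpace K)ˣ := fun i => z i * (r i)⁻¹ with hp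
  have hzrp : z = r * p := by
    funext i; simp only [Pi.mul_apply, hp]; rw [mul_comm (r i), inv_mul_cancel_right]
  -- the phases have modulus one at every place
  have hrinv : ∀ i w, mixedSpaceEvalAt K w (((r i)⁻¹ : (mixedSpace K)ˣ) : mixedSpace K) = (((ρ i w : ℝ) : ℂ))⁻¹ := by
    intro i w
    have h1 : mixedSpaceEvalAt K w ((r i : (mixedSpace K)ˣ) : mixedSpace K) *
        mixedSpaceEvalAt K w (((r i)⁻¹ : (mixedSpace K)ˣ) : mixedSpace K) = 1 := by
      rw [← map_mul, Units.mul_inv, map_one]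
    rw [hr, mixedSpaceEvalAt_mixedPosUnit] at h1
    exact (eq_inv_of_mul_eq_one_right h1)
  have hpnorm : ∀ i w, ‖mixedSpaceEvalAt K w (p i : mixedSpace K)‖ = 1 := by
    intro i w
    simp only [hp, Units.val_mul, map_mul, norm_mul]
    rw [hzn i w, hrinv i w, norm_inv, Complex.norm_real, Real.norm_of_nonneg (hρpos i w).le,
      mul_inv_cancel₀ (hρpos i w).ne']
  -- the decomposition
  set κ : GL (Fin n) (mixedSpace K) :=
    glCorner (mixedSpace K) h (glDiagonal m (mixedSpace K) p * GLn.toMixed m K k) with hκ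
  have hκK : κ ∈ Kinf n K :=
    glCorner_mem_Kinf h ((Kinf m K).mul_mem (glDiagonal_mem_Kinf_of_norm_eq_one hpnorm)
      (toMixed_mem_Kinf_of_mem_standardMaximalCompactGL hk))
  refine ⟨cornerExtend h r 1, κ, hκK, ?_, fun w => ⟨fun i hi => ?_, fun i hi => ?_⟩⟩
  · have hzdiag : GLn.toMixed m K (glDiagonal m (AdeleRing (𝓞 K) K) a) = glDiagonal m (mixedSpace K) z :=
      GLn.toMixed_glDiagonal a
    rw [GLn.toMixed_glCorner, map_mul, hzdiag, hzrp, map_mul (glDiagonal m (mixedSpace K)), mul_assoc,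
      map_mul (glCorner (mixedSpace K) h), glCorner_glDiagonal_eq_glDiagonal_cornerExtend]
  · rw [cornerExtend_apply_of_lt h r 1 i hi, hr, mixedSpaceEvalAt_mixedPosUnit]
  · rw [cornerExtend_apply_of_le h r 1 i hi, Units.val_one, map_one]

end Iwasawa

/-! ### Finite support of `W_φ` at the `GL_n` corner torus points -/

section Majorant

variable {n m : ℕ} {K : Type} [Field K] [NumberField K]

/-- **Finite support at the `GL_n` corner torus points.** Let `φ` on `GL_n(𝔸_K)` be left `GL_n(K)`-invariant
and right `K(𝔫)`-invariant, `m < n`, and let `B_v` be bounds such that `a |𝔫|_v < |x|_v b` for all `x` with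
`ψ_v(x) ≠ 1` forces `a ≤ B_v b` (`exists_finset_bound_adeleAddCharAt`). If `W_φ(ι(diag(a) k)) ≠ 0` then
`|a_{l,v}|_v ≤ B_v^{m-l}` for every finite place `v` and every `l < m` (the simple-root support condition
`valued_lt_of_whittakerDepth_zero_ne_zero` at the finite Iwasawa data `diag(a_f, 1, …, 1) ι(k_f)`, chained down
from the root `(m-1, m)`, whose second entry is `1`). [cite: CogdellAnalyticTheory2004, Thm. 1.1 and §2.3] -/
theorem valued_le_pow_of_whittakerDepth_glCorner_ne_zero (hmn : m < n) {φ : GL (Fin n) (AdeleRing (𝓞 K) K) → ℂ}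
    (hφK : ∀ (γ₀ : GL (Fin n) K) (x : GL (Fin n) (AdeleRing (𝓞 K) K)),
      φ (Matrix.GeneralLinearGroup.map (algebraMap K (AdeleRing (𝓞 K) K)) γ₀ * x) = φ x)
    {𝔫 : Ideal (𝓞 K)} (hφU : ∀ x, ∀ u ∈ principalCongruenceLevel n K 𝔫, φ (x * u) = φ x)
    {B : HeightOneSpectrum (𝓞 K) → WithZero (Multiplicative ℤ)}
    (hB : ∀ (v : HeightOneSpectrum (𝓞 K)) (a b : WithZero (Multiplicative ℤ)),
      (∀ x : v.adicCompletion K, adeleAddCharAt K v x ≠ 1 → a * idealRadius K v 𝔫 < Valued.v x * b) → a ≤ B v * b)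
    {a : Fin m → ideleGroup K} {k : ↥(maximalCompactAdelic m K)}
    (hW : whittakerDepth 0 φ (glCorner (AdeleRing (𝓞 K) K) hmn.le (torusPoint m K (a, k))) ≠ 0)
    (v : HeightOneSpectrum (𝓞 K)) (l : Fin m) :
    Valued.v (((a l : ideleGroup K) : AdeleRing (𝓞 K) K).2 v) ≤ B v ^ (m - l) := by
  obtain ⟨hsnd, hk⟩ := sndHom_glCorner_torusPoint hmn.le a k.2
  set t : Fin n → (FiniteAdeleRing (𝓞 K) K)ˣ :=
    cornerExtend hmn.le
      (fun i => Units.map (RingHom.snd (InfiniteAdeleRing K) (FiniteAdeleRing (𝓞 K) K)).toMonoidHom (a i)) 1 with ht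
  have hW' : whittakerDepth 0 φ (glCorner (AdeleRing (𝓞 K) K) hmn.le
      (glDiagonal m (AdeleRing (𝓞 K) K) a * (show GL (Fin m) (AdeleRing (𝓞 K) K) from
        ((k : ↥(maximalCompactAdelic m K)) : (AdelicGroupData.gl m K).Adelic)))) ≠ 0 := hW
  have hstep : ∀ (j : ℕ) (hj : j + 1 < n),
      Valued.v (((t ⟨j, by omega⟩ : (FiniteAdeleRing (𝓞 K) K)ˣ) : FiniteAdeleRing (𝓞 K) K) v) ≤
        B v * Valued.v (((t ⟨j + 1, hj⟩ : (FiniteAdeleRing (𝓞 K) K)ˣ) : FiniteAdeleRing (𝓞 K) K) v) :=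
    fun j hj => hB v _ _ fun x hx => valued_lt_of_whittakerDepth_zero_ne_zero hφK hφU hk hsnd hW' v hj hx
  have ht_lt : ∀ (i : Fin n) (hi : (i : ℕ) < m),
      ((t i : (FiniteAdeleRing (𝓞 K) K)ˣ) : FiniteAdeleRing (𝓞 K) K) v =
        ((a ⟨i, hi⟩ : ideleGroup K) : AdeleRing (𝓞 K) K).2 v := by
    intro i hi; rw [ht, cornerExtend_apply_of_lt hmn.le _ 1 i hi]; rfl
  have ht_m : ((t ⟨m, hmn⟩ : (FiniteAdeleRing (𝓞 K) K)ˣ) : FiniteAdeleRing (𝓞 K) K) v = 1 := by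
    rw [ht, cornerExtend_apply_of_le hmn.le _ 1 _ le_rfl]; rfl
  have hchain : ∀ (d : ℕ) (l : Fin m), (l : ℕ) + d + 1 = m →
      Valued.v (((a l : ideleGroup K) : AdeleRing (𝓞 K) K).2 v) ≤ B v ^ (d + 1) := by
    intro d
    induction d with
    | zero =>
      intro l hl
      have h := hstep l (by omega)
      have e2 : (⟨(l : ℕ) + 1, by omega⟩ : Fin n) = ⟨m, hmn⟩ := Fin.ext (by simp only; omega)
      rw [e2, ht_lt ⟨l, by omega⟩ l.2, ht_m, map_one, mul_one] at h
      rwa [zero_add, pow_one]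
    | succ d ih =>
      intro l hl
      have hl1 : (l : ℕ) + 1 < m := by omega
      have h := hstep l (by omega)
      rw [ht_lt ⟨l, by omega⟩ l.2, ht_lt ⟨(l : ℕ) + 1, by omega⟩ hl1] at h
      have h2 := ih ⟨(l : ℕ) + 1, hl1⟩ (by simp only; omega)
      calc Valued.v (((a l : ideleGroup K) : AdeleRing (𝓞 K) K).2 v)
          ≤ B v * Valued.v (((a ⟨(l : ℕ) + 1, hl1⟩ : ideleGroup K) : AdeleRing (𝓞 K) K).2 v) := h
        _ ≤ B v * B v ^ (d + 1) := mul_le_mul' le_rfl h2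
        _ = B v ^ (d + 1 + 1) := by rw [pow_succ' _ (d + 1)]
  have h := hchain (m - 1 - l) l (by omega)
  rwa [show m - 1 - (l : ℕ) + 1 = m - l from by omega] at h

/-! ### Archimedean decay of `W_φ` at the `GL_n` corner torus points -/

/-- **Single-coordinate archimedean decay at the `GL_n` corner torus points.** Under the hypotheses of the
telescoped decay theorem (`φ` left `GL_n(K)`-invariant with smooth, continuous, bounded iterated archimedean
derivatives), `m < n`, for every infinite place `w`, exponent `M` and coordinate `l < m` there is `C ≥ 0` with
`‖W_φ(ι(diag(a) k))‖ · ‖a_{l,w}‖^M ≤ C` for all `a ∈ (𝔸_Kˣ)ᵐ`, `k ∈ K_m` (the archimedean Iwasawa data of the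
corner point, `exists_toMixed_glCorner_torusPoint`: radii `‖a_{i,w}‖`, `i < m`, and `1` in the rows `i ≥ m`, in
particular in the last row `n - 1 ≥ m`). [cite: CogdellAnalyticTheory2004, Thm. 1.1 and §2.3] -/
theorem norm_whittakerDepth_glCorner_mul_pow_le (hmn : m < n) {φ : GL (Fin n) (AdeleRing (𝓞 K) K) → ℂ}
    (hφK : ∀ (γ₀ : GL (Fin n) K) (x : GL (Fin n) (AdeleRing (𝓞 K) K)),
      φ (Matrix.GeneralLinearGroup.map (algebraMap K (AdeleRing (𝓞 K) K)) γ₀ * x) = φ x)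
    (hs : ∀ l : List (archGroupGL n K).lie, IsArchSmooth (glArch n K) (iterLieDeriv (glArch n K) l φ))
    (hc : ∀ l : List (archGroupGL n K).lie, Continuous (iterLieDeriv (glArch n K) l φ))
    (hb : ∀ l : List (archGroupGL n K).lie, ∃ C : ℝ, ∀ z, ‖iterLieDeriv (glArch n K) l φ z‖ ≤ C)
    (w : InfinitePlace K) (M : ℕ) (l : Fin m) :
    ∃ C : ℝ, 0 ≤ C ∧ ∀ (a : Fin m → ideleGroup K) (k : ↥(maximalCompactAdelic m K)),
      ‖whittakerDepth 0 φ (glCorner (AdeleRing (𝓞 K) K) hmn.le (torusPoint m K (a, k)))‖ *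
        ‖((a l : ideleGroup K) : AdeleRing (𝓞 K) K).1 w‖ ^ M ≤ C := by
  obtain ⟨C, hC0, hC⟩ :=
    Literature.NumberTheory.Automorphic.exists_norm_whittakerDepth_zero_mul_pow_le hφK hs hc hb w M
      (Fin.castLE hmn.le l)
  refine ⟨C, hC0, fun a k => ?_⟩
  obtain ⟨dd, κ, hκ, htm, hdd⟩ := exists_toMixed_glCorner_torusPoint hmn.le a k.2
  set r : Fin n → ℝ := cornerExtend hmn.le (fun i => ‖((a i : ideleGroup K) : AdeleRing (𝓞 K) K).1 w‖) 1 with hr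
  have hr_lt : ∀ (i : Fin n) (hi : (i : ℕ) < m), r i = ‖((a ⟨i, hi⟩ : ideleGroup K) : AdeleRing (𝓞 K) K).1 w‖ :=
    fun i hi => by rw [hr, cornerExtend_apply_of_lt hmn.le _ 1 i hi]
  have hr_le : ∀ i : Fin n, m ≤ (i : ℕ) → r i = 1 := fun i hi => by rw [hr, cornerExtend_apply_of_le hmn.le _ 1 i hi]
  have hrpos : ∀ i, 0 < r i := by
    intro i
    by_cases hi : (i : ℕ) < m
    · rw [hr_lt i hi, ← norm_mixedSpaceEvalAt_archUnit (a ⟨i, hi⟩) w]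
      exact norm_pos_iff.2 (mixedSpaceEvalAt_unit_ne_zero _ w)
    · rw [hr_le i (not_lt.1 hi)]; exact one_pos
  have hddr : ∀ i, mixedSpaceEvalAt K w (dd i : mixedSpace K) = (r i : ℂ) := by
    intro i
    by_cases hi : (i : ℕ) < m
    · rw [(hdd w).1 i hi, hr_lt i hi]
    · rw [(hdd w).2 i (not_lt.1 hi), hr_le i (not_lt.1 hi), Complex.ofReal_one]
  have h := hC _ dd r κ hrpos hddr hκ htm
  have e1 : r (Fin.castLE hmn.le l) = ‖((a l : ideleGroup K) : AdeleRing (𝓞 K) K).1 w‖ := by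
    rw [hr_lt (Fin.castLE hmn.le l) l.2]; rfl
  have e2 : r ⟨n - 1, Nat.sub_lt (Fin.castLE hmn.le l).pos Nat.one_pos⟩ = 1 := hr_le _ (by simp only; omega)
  rw [e1, e2, one_pow, mul_one] at h
  exact h

/-! ### The registered sub-goal -/

/-- **SUB-GOAL (G-Ac, part 1/2) — single-coordinate archimedean decay of `W_φ` at the `GL_n` corner torus
points**, the `∀`-closed form of `norm_whittakerDepth_glCorner_mul_pow_le` (registered on stmt-Langlands-13622 so
that this helper file lands `--supports`; consumed by part 2, `…GapAbsConvergence.stub_gap_abs_convergence`).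
[cite: CogdellAnalyticTheory2004, Thm. 1.1 and §2.3] -/
theorem stub_gap_single_decay :
    ∀ {n m : ℕ} {K : Type} [Field K] [NumberField K] (hmn : m < n) {φ : GL (Fin n) (AdeleRing (𝓞 K) K) → ℂ},
      (∀ (γ₀ : GL (Fin n) K) (x : GL (Fin n) (AdeleRing (𝓞 K) K)),
        φ (Matrix.GeneralLinearGroup.map (algebraMap K (AdeleRing (𝓞 K) K)) γ₀ * x) = φ x) →
      (∀ l : List (archGroupGL n K).lie, IsArchSmooth (glArch n K) (iterLieDeriv (glArch n K) l φ)) →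
      (∀ l : List (archGroupGL n K).lie, Continuous (iterLieDeriv (glArch n K) l φ)) →
      (∀ l : List (archGroupGL n K).lie, ∃ C : ℝ, ∀ z, ‖iterLieDeriv (glArch n K) l φ z‖ ≤ C) →
      ∀ (w : InfinitePlace K) (M : ℕ) (l : Fin m), ∃ C : ℝ, 0 ≤ C ∧
        ∀ (a : Fin m → ideleGroup K) (k : ↥(maximalCompactAdelic m K)),
          ‖whittakerDepth 0 φ (glCorner (AdeleRing (𝓞 K) K) hmn.le (torusPoint m K (a, k)))‖ *
            ‖((a l : ideleGroup K) : AdeleRing (𝓞 K) K).1 w‖ ^ M ≤ C := by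
  intro n m K _ _ hmn φ hφK hs hc hb w M l
  exact norm_whittakerDepth_glCorner_mul_pow_le hmn hφK hs hc hb w M l

end Majorant

end Summit.Langlands.Langlands.Theorems.GapAbsMajorant

end
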